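import Summits.CriticalPhenomena.CardyFormulaZ2.Theorems.CardyMagicRigidityMarkovCascadeDefs
import Literature.Probability.RandomPlanarGeometry.LoopConfigurationsMetric
import Literature.Probability.Percolation.LoopRepresentationProofs
import HarnessLib

/-!
# `d_CN` gluing for the closed-b.c. domain ensembles and their first generations
# (helper toward stub `stub_cascadeReconstruction`, line `markov-cascade-one-generation`, crux `NestingRigidity`)

Route `CardyMagicRigidity` (sub-problem `CriticalPhenomena/CardyFormulaZ2`), crux
`Summit.CriticalPhenomena.CardyFormulaZ2.Theses.CardyMagicRigidity.NestingRigidity`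
(stmt-CriticalPhenomena-4835), line `markov-cascade-one-generation` (vocabulary:
`Theorems/CardyMagicRigidityMarkovCascadeDefs.lean`).  Every step of the cascade proving
`stub_cascadeReconstruction : KernelTransfer → DomainLawTransfer` (and of `stub_kernelUniqueness`,
`stub_windowLocality`) glues couplings with `LoopConfig.cnLawEDist_triangle`, which needs the OUTER pair
of configuration spaces standard Borel (`standardBorelSpace_bondConfig`, `standardBorelSpace_siteConfig`)
and the outer exceptional event `{d_CN(X ω, X' ω') ≤ ε}` measurable.  This file proves, sorry-free:

* the closed-b.c. domain ensembles `domLoopsZ2 U δ`, `domLoopsT U δ` are COUNTABLY GENERATED with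
  measurable generating events (`gen_domLoopsZ2`, `measurableSet_gen_domLoopsZ2`, `gen_domLoopsT`,
  `measurableSet_gen_domLoopsT`; the boundary-condition map `ω ↦ ω ∩ M` is measurable,
  `measurable_inter_const`), and so is the FIRST GENERATION of any countably generated configuration
  (`gen_firstGen`, `measurableSet_gen_firstGen`: intersect each generating event with the countably many
  conditions "no switched-on loop has a strictly larger winding interior");
* the mixed exceptional events of `DomainLawTransfer` and `KernelTransfer` are measurable
  (`measurableSet_isClose_domLoopsZ2_domLoopsT`, `measurableSet_isClose_firstGen_domLoopsZ2_domLoopsT`,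
  `measurableSet_isClose_domLoopsT_domLoopsT`);
* the gluing estimates through an arbitrary middle law (`cnLawEDist_domLoops_le_add`,
  `cnLawEDist_firstGen_domLoops_le_add`) and the ONE-GENERATION STEP of the cascade (registered helper
  `cnLawEDist_firstGen_three_domains`): "`ℤ²` in its hole `U` vs `𝕋` in the same hole (`KernelTransfer`)
  vs `𝕋` in its own close hole `U''` (Camia–Newman continuity in the domain, the input absent from the
  tree)": `d_CN(Z²_U, 𝕋_{U''}) ≤ d_CN(Z²_U, 𝕋_{U'}) + d_CN(𝕋_{U'}, 𝕋_{U''})` for first generations.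
-/

noncomputable section

open MeasureTheory Set Filter Metric
open scoped Topology BigOperators ENNReal Real

namespace Summit.CriticalPhenomena.CardyFormulaZ2.Cruxes.NestingRigidity.MarkovCascadeOneGeneration

open Literature.Probability.RandomPlanarGeometry Literature.Probability.Percolation
  Literature.Probability.LatticeModels
open Summit.CriticalPhenomena.CardyFormulaZ2.Theses.CardyMagicRigidity

/-! ### Countable generation of the domain ensembles and of their first generations

Every `d_CN` gluing step of the cascade (`LoopConfig.cnLawEDist_triangle`) needs the exceptional
event `{d_CN(X, X') > ε}` of the OUTER pair to be measurable; for countably generated random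
configurations this is `LoopConfig.measurableSet_isClose_of_gen`.  We record the generating
families of `domLoopsZ2 U δ`, `domLoopsT U δ` and of `firstGen ∘ X` for any countably generated `X`. -/

/-- Intersecting with a fixed set of edges / sites (imposing the closed boundary condition) is a
measurable self-map of the configuration space. -/
theorem measurable_inter_const {X : Type*} (M : Set X) : Measurable fun ω : Set X ↦ ω ∩ M :=
  measurable_set_iff.2 fun a ↦ by
    simp only [mem_inter_iff]
    exact (measurable_set_mem a).and measurable_const

/-- **`domLoopsZ2 U δ` is countably generated**: by the loops of the nonempty dart lists `γ`,
switched on by the events "`γ` is an interface loop of `ω ∩ meshEdges U δ` of type `i` visiting an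
edge of `U_δ`". -/
theorem gen_domLoopsZ2 (U : Set ℂ) (δ : ℝ) :
    ∀ (ω : BondConfig (Site 2)) (i : Fin 2) (u : UnbasedLoop ℂ),
      u ∈ (domLoopsZ2 U δ ω).F i ↔ ∃ k : {γ : List MedialVertex // γ ≠ []},
        ω ∈ {ω | IsInterfaceLoop (ω ∩ meshEdges U δ) k.1 ∧ loopType k.1 = i ∧
          ∃ e ∈ k.1, e ∈ meshEdges U δ} ∧
        UnbasedLoop.mk (BasedLoop.mk (loopCurve δ 0 k.1) (isLoop_loopCurve δ 0 k.2)) = u := by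
  intro ω i u
  constructor
  · rintro ⟨γ, h, ht, he, rfl⟩
    exact ⟨⟨γ, h.ne_nil⟩, ⟨h, ht, he⟩, rfl⟩
  · rintro ⟨⟨γ, hγ⟩, ⟨h, ht, he⟩, rfl⟩
    exact ⟨γ, h, ht, he, rfl⟩

/-- The generating events of `gen_domLoopsZ2` are measurable (`measurable_isInterfaceLoop` composed
with the measurable boundary-condition map `ω ↦ ω ∩ meshEdges U δ`). -/
theorem measurableSet_gen_domLoopsZ2 (U : Set ℂ) (δ : ℝ) (i : Fin 2)
    (k : {γ : List MedialVertex // γ ≠ []}) :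
    MeasurableSet {ω : BondConfig (Site 2) | IsInterfaceLoop (ω ∩ meshEdges U δ) k.1 ∧
      loopType k.1 = i ∧ ∃ e ∈ k.1, e ∈ meshEdges U δ} :=
  measurableSet_setOf.2 <|
    ((measurable_isInterfaceLoop k.1).comp (measurable_inter_const (meshEdges U δ))).and
      measurable_const

/-- **`domLoopsT U δ` is countably generated**: by the loops of the closed honeycomb walks, switched
on by the pull-backs of the generating events of `siteLoopConfig δ` along the boundary-condition
map `ω ↦ ω ∩ triMeshVertices U δ` (`gen_siteLoopConfig`, `LoopConfig.gen_comp`). -/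
theorem gen_domLoopsT (U : Set ℂ) (δ : ℝ) :
    ∀ (ω : SiteConfig (Site 2)) (i : Fin 2) (u : UnbasedLoop ℂ),
      u ∈ (domLoopsT U δ ω).F i ↔ ∃ k : Σ v : HexVertex, hexGraph.Walk v v,
        ω ∈ (fun ω : SiteConfig (Site 2) ↦ ω ∩ triMeshVertices U δ) ⁻¹'
          {ω : SiteConfig (Site 2) | IsSiteInterfaceLoop ω k.2 ∧
            (i = 1 ↔ 0 < shoelace (k.2.support.map hexCenter))} ∧
        UnbasedLoop.mk (BasedLoop.mk (siteLoopCurve δ k.2) (isLoop_siteLoopCurve δ k.2)) = u :=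
  LoopConfig.gen_comp (gen_siteLoopConfig δ) fun ω : SiteConfig (Site 2) ↦ ω ∩ triMeshVertices U δ

/-- The generating events of `gen_domLoopsT` are measurable. -/
theorem measurableSet_gen_domLoopsT (U : Set ℂ) (δ : ℝ) (i : Fin 2)
    (k : Σ v : HexVertex, hexGraph.Walk v v) :
    MeasurableSet ((fun ω : SiteConfig (Site 2) ↦ ω ∩ triMeshVertices U δ) ⁻¹'
      {ω : SiteConfig (Site 2) | IsSiteInterfaceLoop ω k.2 ∧
        (i = 1 ↔ 0 < shoelace (k.2.support.map hexCenter))}) :=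
  measurable_inter_const (triMeshVertices U δ) (measurableSet_gen_siteLoopConfig i k)

/-- **The first generation of a countably generated configuration is countably generated**: same
loops, each generating event intersected with the countably many conditions "no generating loop
that is switched on has a strictly larger winding interior". -/
theorem gen_firstGen {Ω ι : Type*} {X : Ω → LoopConfig ℂ} {f : Fin 2 → ι → UnbasedLoop ℂ}
    {S : Fin 2 → ι → Set Ω} (hX : ∀ ω i u, u ∈ (X ω).F i ↔ ∃ k, ω ∈ S i k ∧ f i k = u) :
    ∀ ω i u, u ∈ (firstGen (X ω)).F i ↔ ∃ k, ω ∈ S i k ∩ {ω | ∀ i' k', ω ∈ S i' k' →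
      ¬ ({z | (f i k).wind z ≠ 0} ⊂ {z | (f i' k').wind z ≠ 0})} ∧ f i k = u := by
  intro ω i u
  have hloops : ∀ v, v ∈ (X ω).loops ↔ ∃ i' k', ω ∈ S i' k' ∧ f i' k' = v := by
    intro v
    rw [LoopConfig.mem_loops_iff]
    constructor
    · rintro (hv | hv)
      · obtain ⟨k', hk', rfl⟩ := (hX ω 0 v).1 hv; exact ⟨0, k', hk', rfl⟩
      · obtain ⟨k', hk', rfl⟩ := (hX ω 1 v).1 hv; exact ⟨1, k', hk', rfl⟩
    · rintro ⟨i', k', hk', rfl⟩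
      fin_cases i'
      · exact Or.inl ((hX ω 0 _).2 ⟨k', hk', rfl⟩)
      · exact Or.inr ((hX ω 1 _).2 ⟨k', hk', rfl⟩)
  constructor
  · rintro ⟨hu, hmax⟩
    obtain ⟨k, hk, rfl⟩ := (hX ω i u).1 hu
    refine ⟨k, ⟨hk, fun i' k' hk' ↦ hmax _ ((hloops _).2 ⟨i', k', hk', rfl⟩)⟩, rfl⟩
  · rintro ⟨k, ⟨hk, hmax⟩, rfl⟩
    refine ⟨(hX ω i _).2 ⟨k, hk, rfl⟩, fun v hv ↦ ?_⟩
    obtain ⟨i', k', hk', rfl⟩ := (hloops v).1 hv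
    exact hmax i' k' hk'

/-- The generating events of `gen_firstGen` are measurable when the original ones are and the index
type is countable. -/
theorem measurableSet_gen_firstGen {Ω ι : Type*} [MeasurableSpace Ω] [Countable ι]
    {f : Fin 2 → ι → UnbasedLoop ℂ} {S : Fin 2 → ι → Set Ω} (hS : ∀ i k, MeasurableSet (S i k))
    (i : Fin 2) (k : ι) :
    MeasurableSet (S i k ∩ {ω | ∀ i' k', ω ∈ S i' k' →
      ¬ ({z | (f i k).wind z ≠ 0} ⊂ {z | (f i' k').wind z ≠ 0})}) :=
  (hS i k).inter <| measurableSet_setOf.2 <| Measurable.forall fun i' ↦ Measurable.forall fun k' ↦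
    (measurableSet_setOf.1 (hS i' k')).imp measurable_const

/-! ### Measurability of the exceptional events and the gluing estimates of the cascade -/

/-- **The mixed exceptional event of the domain ensembles is measurable**:
`{(ω, ω') | d_CN(domLoopsZ2 U δ ω, domLoopsT U' δ' ω') ≤ ε}` is measurable on
`BondConfig (Site 2) × SiteConfig (Site 2)` (hypothesis `hm` of `LoopConfig.cnLawEDist_triangle` for
the outer pair of `DomainLawTransfer`). -/
theorem measurableSet_isClose_domLoopsZ2_domLoopsT (U U' : Set ℂ) (δ δ' ε : ℝ) :
    MeasurableSet {p : BondConfig (Site 2) × SiteConfig (Site 2) |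
      LoopConfig.IsClose ε (domLoopsZ2 U δ p.1) (domLoopsT U' δ' p.2)} := by
  haveI := countable_sigma_hexLoop
  exact LoopConfig.measurableSet_isClose_of_gen (measurableSet_gen_domLoopsZ2 U δ) (gen_domLoopsZ2 U δ)
    (measurableSet_gen_domLoopsT U' δ') (gen_domLoopsT U' δ') ε

/-- **The mixed exceptional event of the FIRST GENERATIONS is measurable**:
`{(ω, ω') | d_CN(firstGen (domLoopsZ2 U δ ω), firstGen (domLoopsT U' δ' ω')) ≤ ε}` is measurable
(hypothesis `hm` of `LoopConfig.cnLawEDist_triangle` for the outer pair of `KernelTransfer`). -/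
theorem measurableSet_isClose_firstGen_domLoopsZ2_domLoopsT (U U' : Set ℂ) (δ δ' ε : ℝ) :
    MeasurableSet {p : BondConfig (Site 2) × SiteConfig (Site 2) |
      LoopConfig.IsClose ε (firstGen (domLoopsZ2 U δ p.1)) (firstGen (domLoopsT U' δ' p.2))} := by
  haveI := countable_sigma_hexLoop
  exact LoopConfig.measurableSet_isClose_of_gen
    (X := fun ω ↦ firstGen (domLoopsZ2 U δ ω)) (X' := fun ω ↦ firstGen (domLoopsT U' δ' ω))
    (measurableSet_gen_firstGen (measurableSet_gen_domLoopsZ2 U δ)) (gen_firstGen (gen_domLoopsZ2 U δ))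
    (measurableSet_gen_firstGen (measurableSet_gen_domLoopsT U' δ'))
    (gen_firstGen (gen_domLoopsT U' δ')) ε

/-- The site–site exceptional event of two domain ensembles on `𝕋` (different domains / meshes) is
measurable — the outer pair of the `𝕋`-side continuity-in-the-domain comparisons of the cascade. -/
theorem measurableSet_isClose_domLoopsT_domLoopsT (U U' : Set ℂ) (δ δ' ε : ℝ) :
    MeasurableSet {p : SiteConfig (Site 2) × SiteConfig (Site 2) |
      LoopConfig.IsClose ε (domLoopsT U δ p.1) (domLoopsT U' δ' p.2)} := by
  haveI := countable_sigma_hexLoop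
  exact LoopConfig.measurableSet_isClose_of_gen (measurableSet_gen_domLoopsT U δ) (gen_domLoopsT U δ)
    (measurableSet_gen_domLoopsT U' δ') (gen_domLoopsT U' δ') ε

/-- The bond–bond exceptional event of two domain ensembles on `ℤ²` (different domains / meshes) is
measurable — the outer pair of the `ℤ²`-side comparisons of the cascade (planar duality with its half-mesh
shift compares `domLoopsZ2` in a hole and in the shifted hole). -/
theorem measurableSet_isClose_domLoopsZ2_domLoopsZ2 (U U' : Set ℂ) (δ δ' ε : ℝ) :
    MeasurableSet {p : BondConfig (Site 2) × BondConfig (Site 2) |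
      LoopConfig.IsClose ε (domLoopsZ2 U δ p.1) (domLoopsZ2 U' δ' p.2)} :=
  LoopConfig.measurableSet_isClose_of_gen (measurableSet_gen_domLoopsZ2 U δ) (gen_domLoopsZ2 U δ)
    (measurableSet_gen_domLoopsZ2 U' δ') (gen_domLoopsZ2 U' δ') ε

/-- **Gluing estimate for the domain ensembles**: for every probability space `(Ω, P)` and every
random typed configuration `Y` on it,
`d_CN(domLoopsZ2 U δ, domLoopsT U' δ') ≤ d_CN(domLoopsZ2 U δ, (P, Y)) + d_CN(domLoopsT U' δ', (P, Y))`
(`LoopConfig.cnLawEDist_triangle` with the lattice spaces as the standard Borel outer pair and the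
measurable mixed event above; no hypothesis on the middle law). -/
theorem cnLawEDist_domLoops_le_add {Ω : Type*} [MeasurableSpace Ω] (P : Measure Ω)
    [IsProbabilityMeasure P] (Y : Ω → LoopConfig ℂ) (U U' : Set ℂ) (δ δ' : ℝ) :
    LoopConfig.cnLawEDist P2 (domLoopsZ2 U δ) PT (domLoopsT U' δ') ≤
      LoopConfig.cnLawEDist P2 (domLoopsZ2 U δ) P Y + LoopConfig.cnLawEDist PT (domLoopsT U' δ') P Y := by
  haveI := standardBorelSpace_bondConfig
  haveI := standardBorelSpace_siteConfig
  calc LoopConfig.cnLawEDist P2 (domLoopsZ2 U δ) PT (domLoopsT U' δ')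
      ≤ LoopConfig.cnLawEDist P2 (domLoopsZ2 U δ) P Y + LoopConfig.cnLawEDist P Y PT (domLoopsT U' δ') :=
        LoopConfig.cnLawEDist_triangle P2 P PT (domLoopsZ2 U δ) Y (domLoopsT U' δ')
          (measurableSet_isClose_domLoopsZ2_domLoopsT U U' δ δ')
    _ = _ := by rw [LoopConfig.cnLawEDist_comm P Y]

/-- **Gluing estimate for the first generations** (through an arbitrary middle law):
`d_CN(firstGen ∘ domLoopsZ2 U δ, firstGen ∘ domLoopsT U' δ') ≤
  d_CN(firstGen ∘ domLoopsZ2 U δ, (P, Y)) + d_CN(firstGen ∘ domLoopsT U' δ', (P, Y))`. -/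
theorem cnLawEDist_firstGen_domLoops_le_add {Ω : Type*} [MeasurableSpace Ω] (P : Measure Ω)
    [IsProbabilityMeasure P] (Y : Ω → LoopConfig ℂ) (U U' : Set ℂ) (δ δ' : ℝ) :
    LoopConfig.cnLawEDist P2 (fun ω ↦ firstGen (domLoopsZ2 U δ ω)) PT
        (fun ω ↦ firstGen (domLoopsT U' δ' ω)) ≤
      LoopConfig.cnLawEDist P2 (fun ω ↦ firstGen (domLoopsZ2 U δ ω)) P Y +
        LoopConfig.cnLawEDist PT (fun ω ↦ firstGen (domLoopsT U' δ' ω)) P Y := by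
  haveI := standardBorelSpace_bondConfig
  haveI := standardBorelSpace_siteConfig
  calc LoopConfig.cnLawEDist P2 (fun ω ↦ firstGen (domLoopsZ2 U δ ω)) PT
        (fun ω ↦ firstGen (domLoopsT U' δ' ω))
      ≤ LoopConfig.cnLawEDist P2 (fun ω ↦ firstGen (domLoopsZ2 U δ ω)) P Y +
          LoopConfig.cnLawEDist P Y PT (fun ω ↦ firstGen (domLoopsT U' δ' ω)) :=
        LoopConfig.cnLawEDist_triangle P2 P PT _ Y _
          (measurableSet_isClose_firstGen_domLoopsZ2_domLoopsT U U' δ δ')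
    _ = _ := by rw [LoopConfig.cnLawEDist_comm P Y]

/-- **The one-generation step of the cascade (registered helper toward `stub_cascadeReconstruction`)**:
the `𝕋`-side domain comparison glued onto `KernelTransfer`'s conclusion. For three domains,
`d_CN(firstGen ∘ domLoopsZ2 U δ, firstGen ∘ domLoopsT U'' δ) ≤
  d_CN(firstGen ∘ domLoopsZ2 U δ, firstGen ∘ domLoopsT U' δ) +
  d_CN(firstGen ∘ domLoopsT U' δ, firstGen ∘ domLoopsT U'' δ)` — "`ℤ²` in its hole vs `𝕋` in the
same hole vs `𝕋` in its own close hole", the one-generation step of the cascade. -/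
theorem cnLawEDist_firstGen_three_domains : ∀ (U U' U'' : Set ℂ) (δ : ℝ),
    LoopConfig.cnLawEDist P2 (fun ω ↦ firstGen (domLoopsZ2 U δ ω)) PT
        (fun ω ↦ firstGen (domLoopsT U'' δ ω)) ≤
      LoopConfig.cnLawEDist P2 (fun ω ↦ firstGen (domLoopsZ2 U δ ω)) PT
          (fun ω ↦ firstGen (domLoopsT U' δ ω)) +
        LoopConfig.cnLawEDist PT (fun ω ↦ firstGen (domLoopsT U' δ ω)) PT
          (fun ω ↦ firstGen (domLoopsT U'' δ ω)) := by
  intro U U' U'' δ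
  haveI := standardBorelSpace_bondConfig
  haveI := standardBorelSpace_siteConfig
  exact LoopConfig.cnLawEDist_triangle P2 PT PT _ _ _
    (measurableSet_isClose_firstGen_domLoopsZ2_domLoopsT U U'' δ δ)

/-- The mirror one-generation step, with the intermediate comparison on the `ℤ²` side:
`d_CN(Z²_U, 𝕋_{U''}) ≤ d_CN(Z²_U, Z²_{U'}) + d_CN(Z²_{U'}, 𝕋_{U''})` for first generations (the shape of
the planar-duality step, `U'` a half-mesh shift of `U`). -/
theorem cnLawEDist_firstGen_three_domains' (U U' U'' : Set ℂ) (δ : ℝ) :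
    LoopConfig.cnLawEDist P2 (fun ω ↦ firstGen (domLoopsZ2 U δ ω)) PT
        (fun ω ↦ firstGen (domLoopsT U'' δ ω)) ≤
      LoopConfig.cnLawEDist P2 (fun ω ↦ firstGen (domLoopsZ2 U δ ω)) P2
          (fun ω ↦ firstGen (domLoopsZ2 U' δ ω)) +
        LoopConfig.cnLawEDist P2 (fun ω ↦ firstGen (domLoopsZ2 U' δ ω)) PT
          (fun ω ↦ firstGen (domLoopsT U'' δ ω)) := by
  haveI := standardBorelSpace_bondConfig
  haveI := standardBorelSpace_siteConfig
  exact LoopConfig.cnLawEDist_triangle P2 P2 PT _ _ _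
    (measurableSet_isClose_firstGen_domLoopsZ2_domLoopsT U U'' δ δ)

end Summit.CriticalPhenomena.CardyFormulaZ2.Cruxes.NestingRigidity.MarkovCascadeOneGeneration

end
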